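import Mathlib

/-!
# Measurable inverses of injective measurable maps on Borel sets (Lusin–Souslin), plain and FIBREWISE

A standard Borel space `X`, a countably separated measurable space `Y`, a measurable `F : X → Y` injective on a measurable set `D ⊆ X`.
By the Lusin–Souslin theorem (Mathlib `MeasurableSet.image_of_measurable_injOn`, [Kechris1995] Thm. 15.1) the image `F '' D` and the images
`F '' (D ∩ A)` of measurable `A` are measurable; hence THE INVERSE `(F '' D).piecewise (invFunOn F D) (fun _ ↦ x₀)` — the unique preimage in `D`
on the image, a constant elsewhere — IS MEASURABLE (§1), a left inverse on `D` and a right inverse on `F '' D`.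

§2 is the FIBREWISE form used by fibred charts built from private coordinates (`Literature.MathematicalPhysics.QuantumFieldTheory.Balaban1983to89.
T4TriangularFibredChart`, whose per-factor data are an environment-dependent window `Ω(e)`, a JOINTLY measurable local inverse `θ(e, ·)` and the image
window `T(e)`): for a jointly measurable family `Ψ : E × G → G` of one-variable maps, each `Ψ(e, ·)` injective on a window `Ω(e)` with
`{(e, g) | g ∈ Ω(e)}` measurable, the graph map `(e, g) ↦ (e, Ψ(e, g))` is injective on that set, so §1 produces ONE jointly measurable
`θ : E × G → G` with `θ(e, Ψ(e, g)) = g` on the windows and `Ψ(e, θ(e, v)) = v` on the (jointly measurable) image windows — no choice per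
environment, no parametric inverse-function theorem.  Pure measure theory over Mathlib; nothing else is used or asserted.
-/

noncomputable section

open Set Function

namespace Literature.MeasureTheory.Function

open _root_.MeasureTheory

/-! ## §1  The measurable inverse of an injective measurable map on a Borel set -/

section Plain

variable {X Y : Type*} [MeasurableSpace X] [StandardBorelSpace X] [Nonempty X] [MeasurableSpace Y]
  [MeasurableSpace.CountablySeparated Y] {F : X → Y} {D : Set X}

omit [MeasurableSpace X] [StandardBorelSpace X] [MeasurableSpace Y] [MeasurableSpace.CountablySeparated Y] in
/-- **Lusin–Souslin, preimage form.**  For `F` measurable and injective on the measurable set `D`, and `A` measurable, the set of image points whose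
`D`-preimage lies in `A` — `F '' D ∩ (invFunOn F D) ⁻¹' A = F '' (D ∩ A)` — is measurable. [cite: Kechris1995, Thm 15.1] -/
theorem image_inter_preimage_invFunOn_eq (hinj : InjOn F D) (A : Set X) :
    F '' D ∩ invFunOn F D ⁻¹' A = F '' (D ∩ A) := by
  ext y
  constructor
  · rintro ⟨⟨x, hxD, rfl⟩, hA⟩
    exact ⟨x, ⟨hxD, by simpa [hinj.leftInvOn_invFunOn hxD] using hA⟩, rfl⟩
  · rintro ⟨x, ⟨hxD, hxA⟩, rfl⟩
    exact ⟨⟨x, hxD, rfl⟩, by simpa [mem_preimage, hinj.leftInvOn_invFunOn hxD] using hxA⟩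

/-- ★ **THE MEASURABLE INVERSE** (Lusin–Souslin): for `F : X → Y` measurable and injective on the measurable set `D` (`X` standard Borel, `Y` countably
separated), the map equal to the `D`-preimage on `F '' D` and to the constant `x₀` off it is measurable. [cite: Kechris1995, Thm 15.1 and Cor 15.2] -/
theorem measurable_piecewise_invFunOn (hD : MeasurableSet D) (hF : Measurable F) (hinj : InjOn F D) (x₀ : X)
    [DecidablePred (· ∈ F '' D)] :
    Measurable ((F '' D).piecewise (invFunOn F D) (fun _ => x₀)) := by
  have himg : MeasurableSet (F '' D) := hD.image_of_measurable_injOn hF hinj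
  refine measurable_of_restrict_of_restrict_compl himg ?_ ?_
  · rw [restrict_piecewise]
    intro A hA
    have h1 : MeasurableSet (F '' (D ∩ A)) := (hD.inter hA).image_of_measurable_injOn hF (hinj.mono inter_subset_left)
    have h2 : (F '' D).restrict (invFunOn F D) ⁻¹' A = ((↑) : F '' D → Y) ⁻¹' (F '' (D ∩ A)) := by
      ext ⟨y, hy⟩
      simp only [mem_preimage, restrict_apply]
      constructor
      · intro hA'
        have : y ∈ F '' D ∩ invFunOn F D ⁻¹' A := ⟨hy, hA'⟩
        rwa [image_inter_preimage_invFunOn_eq hinj] at this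
      · intro hy'
        have : y ∈ F '' D ∩ invFunOn F D ⁻¹' A := by
          rw [image_inter_preimage_invFunOn_eq hinj]; exact hy'
        exact this.2
    rw [h2]
    exact measurable_subtype_coe h1
  · rw [restrict_piecewise_compl]
    exact measurable_const

omit [MeasurableSpace X] [StandardBorelSpace X] [MeasurableSpace Y] [MeasurableSpace.CountablySeparated Y] in
/-- The measurable inverse is a LEFT inverse on `D`. [cite: Kechris1995, Cor 15.2] -/
theorem piecewise_invFunOn_apply (hinj : InjOn F D) (x₀ : X) [DecidablePred (· ∈ F '' D)] {x : X} (hx : x ∈ D) :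
    (F '' D).piecewise (invFunOn F D) (fun _ => x₀) (F x) = x := by
  rw [piecewise_eq_of_mem _ _ _ (mem_image_of_mem F hx)]
  exact hinj.leftInvOn_invFunOn hx

omit [MeasurableSpace X] [StandardBorelSpace X] [MeasurableSpace Y] [MeasurableSpace.CountablySeparated Y] in
/-- The measurable inverse is a RIGHT inverse on the image `F '' D`, with values in `D`. [cite: Kechris1995, Cor 15.2] -/
theorem apply_piecewise_invFunOn (x₀ : X) [DecidablePred (· ∈ F '' D)] {y : Y} (hy : y ∈ F '' D) :
    F ((F '' D).piecewise (invFunOn F D) (fun _ => x₀) y) = y ∧ (F '' D).piecewise (invFunOn F D) (fun _ => x₀) y ∈ D := by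
  rw [piecewise_eq_of_mem _ _ _ hy]
  obtain ⟨x, hx, rfl⟩ := hy
  exact ⟨invFunOn_eq ⟨x, hx, rfl⟩, invFunOn_mem ⟨x, hx, rfl⟩⟩

/-- ★ **PACKAGED**: a measurable two-sided inverse on (`D`, `F '' D`) exists, and the image is measurable. [cite: Kechris1995, Thm 15.1 and Cor 15.2] -/
theorem exists_measurable_inverseOn (hD : MeasurableSet D) (hF : Measurable F) (hinj : InjOn F D) :
    MeasurableSet (F '' D) ∧ ∃ θ : Y → X, Measurable θ ∧ (∀ x ∈ D, θ (F x) = x) ∧ (∀ y ∈ F '' D, F (θ y) = y ∧ θ y ∈ D) := by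
  classical
  obtain ⟨x₀⟩ := (inferInstance : Nonempty X)
  exact ⟨hD.image_of_measurable_injOn hF hinj, (F '' D).piecewise (invFunOn F D) (fun _ => x₀),
    measurable_piecewise_invFunOn hD hF hinj x₀, fun x hx => piecewise_invFunOn_apply hinj x₀ hx,
    fun y hy => apply_piecewise_invFunOn x₀ hy⟩

end Plain

/-! ## §2  Fibrewise: ONE jointly measurable inverse for a measurable family of maps injective on environment-dependent windows -/

section Fibrewise

variable {E G : Type*} [MeasurableSpace E] [MeasurableSpace G] [StandardBorelSpace E] [StandardBorelSpace G] [Nonempty E] [Nonempty G]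
  {Ψ : E × G → G} {Ω : E → Set G}

omit [MeasurableSpace E] [MeasurableSpace G] [StandardBorelSpace E] [StandardBorelSpace G] [Nonempty E] [Nonempty G] in
/-- The graph map `(e, g) ↦ (e, Ψ(e, g))` is injective on `{(e, g) | g ∈ Ω(e)}` as soon as each `Ψ(e, ·)` is injective on `Ω(e)`.
[cite: Kechris1995, Cor 15.2 (bookkeeping)] -/
theorem injOn_graphMap (hinj : ∀ e, InjOn (fun g => Ψ (e, g)) (Ω e)) :
    InjOn (fun p : E × G => (p.1, Ψ p)) {p : E × G | p.2 ∈ Ω p.1} := by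
  rintro ⟨e, g⟩ hg ⟨e', g'⟩ hg' h
  simp only [Prod.mk.injEq] at h
  obtain ⟨rfl, hΨ⟩ := h
  exact Prod.ext rfl (hinj e hg hg' hΨ)

omit [MeasurableSpace E] [MeasurableSpace G] [StandardBorelSpace E] [StandardBorelSpace G] [Nonempty E] [Nonempty G] in
/-- The image of the windows under the graph map is the family of IMAGE WINDOWS: `(e, v)` lies in it iff `v ∈ Ψ(e, ·) '' Ω(e)`.
[cite: Kechris1995, Cor 15.2 (bookkeeping)] -/
theorem mem_image_graphMap_iff (e : E) (v : G) :
    (e, v) ∈ (fun p : E × G => (p.1, Ψ p)) '' {p : E × G | p.2 ∈ Ω p.1} ↔ v ∈ (fun g => Ψ (e, g)) '' Ω e := by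
  constructor
  · rintro ⟨⟨e', g'⟩, hg', h⟩
    simp only [Prod.mk.injEq] at h
    obtain ⟨rfl, rfl⟩ := h
    exact ⟨g', hg', rfl⟩
  · rintro ⟨g, hg, rfl⟩
    exact ⟨(e, g), hg, rfl⟩

/-- ★★ **THE FIBREWISE MEASURABLE INVERSE.**  `E`, `G` standard Borel; `Ψ : E × G → G` jointly measurable; windows `Ω(e) ⊆ G` with `{(e,g) | g ∈ Ω(e)}`
measurable; each `Ψ(e, ·)` injective on `Ω(e)`.  THEN the image windows `T(e) := Ψ(e,·) '' Ω(e)` are jointly measurable (`{(e,v) | v ∈ T(e)}` is a measurable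
set) and there is ONE jointly measurable `θ : E × G → G` with `θ(e, Ψ(e,g)) = g` for `g ∈ Ω(e)` and, for `v ∈ T(e)`, `Ψ(e, θ(e,v)) = v` with `θ(e,v) ∈ Ω(e)` —
the per-factor inversion data (`T`, `θ`, `hright`) of a private-coordinate fibred chart, from injectivity windows alone. [cite: Kechris1995, Thm 15.1 and Cor 15.2] -/
theorem exists_measurable_fibrewiseInverse (hΨ : Measurable Ψ) (hΩ : MeasurableSet {p : E × G | p.2 ∈ Ω p.1})
    (hinj : ∀ e, InjOn (fun g => Ψ (e, g)) (Ω e)) :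
    MeasurableSet {p : E × G | p.2 ∈ (fun g => Ψ (p.1, g)) '' Ω p.1} ∧
      ∃ θ : E × G → G, Measurable θ ∧ (∀ e, ∀ g ∈ Ω e, θ (e, Ψ (e, g)) = g) ∧
        ∀ e, ∀ v ∈ (fun g => Ψ (e, g)) '' Ω e, Ψ (e, θ (e, v)) = v ∧ θ (e, v) ∈ Ω e := by
  have hF : Measurable (fun p : E × G => (p.1, Ψ p)) := measurable_fst.prodMk hΨ
  obtain ⟨himg, Θ, hΘm, hleft, hright⟩ := exists_measurable_inverseOn hΩ hF (injOn_graphMap hinj)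
  have hset : {p : E × G | p.2 ∈ (fun g => Ψ (p.1, g)) '' Ω p.1} = (fun p : E × G => (p.1, Ψ p)) '' {p : E × G | p.2 ∈ Ω p.1} := by
    ext ⟨e, v⟩
    exact (mem_image_graphMap_iff e v).symm
  refine ⟨by rw [hset]; exact himg, fun p => (Θ p).2, measurable_snd.comp hΘm, fun e g hg => ?_, fun e v hv => ?_⟩
  · have h := hleft (e, g) hg
    exact congrArg Prod.snd h
  · have hv' : (e, v) ∈ (fun p : E × G => (p.1, Ψ p)) '' {p : E × G | p.2 ∈ Ω p.1} := (mem_image_graphMap_iff e v).2 hv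
    obtain ⟨h1, h2⟩ := hright (e, v) hv'
    have hfst : (Θ (e, v)).1 = e := by
      have := congrArg Prod.fst h1
      exact this
    have hΘ : Θ (e, v) = (e, (Θ (e, v)).2) := Prod.ext hfst rfl
    refine ⟨?_, ?_⟩
    · have := congrArg Prod.snd h1
      rw [hΘ] at this
      exact this
    · have : (Θ (e, v)).2 ∈ Ω (Θ (e, v)).1 := h2
      rwa [hfst] at this

end Fibrewise

end Literature.MeasureTheory.Function

end
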